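import Summits.QuantumFields.YangMills.Theorems.PoincareLipschitzKnitFlatEndgameLetters
import Summits.QuantumFields.YangMills.Theorems.PoincareLipschitzKnitLadderLetters
import Summits.QuantumFields.YangMills.Theorems.PoincareLipschitzOrbitMinTwistSlack
import HarnessLib

/-!
# Crux stmt-QuantumFields-19936 `UnitScaleTilt.HistoryTailL`, route crux `PoincareLipschitz.BlockLipschitzL` (stmt-QuantumFields-23533), K2 — K-4a LETTERS for
# «THE ORGAN REDUCED TO ITS CORE» (`hImprove` v1 ⟸ `hImproveCore`): the log-free one-step socket at the centre and the pure-real read-off at the window radius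

Cell `ym3-torus` (YM ladder rung R3 = continuum SU(2) Yang–Mills on the three-torus — a RUNG, NOT the Clay problem: not d = 4, not infinite volume, not a mass
gap); width seat `ym-ust-19936-w2` gen 12 (LEAD ym-ust-19936-w1 g9 2026-08-29T08:04:16Z «K-4 pen = w2»).  THEOREMS ONLY (def-free); `--supports
stmt-QuantumFields-19936 --as helper`.  Letters of K-4b ✓∕⧗`PoincareLipschitzImproveOfCore.hImprove_of_core`; nothing here proves `hImproveCore`, `hImprove`,
`hRegH`, a stub, `BlockLipschitzL`, `HistoryTailL` or a summit statement.
* §1 `twist_le_two_mul_flat_add` (`E_τ ≤ 2E + 2τ₀²N`, from ✓`energy_twist_le`) · `window_radius` (`⌊x⌋ ≤ x ≤ 2⌊x⌋`, `x ≥ 2`) · `sixteen_le_of_sq`.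
* §2 PURE-REAL ROWS OF THE READ-OFF: `top_threshold_logFree` (`E_top ≤ 2E_τ(Q_{2r₀}) + 750τ₀²r₀³ ≤ ε₁m^K`), `envelope_main_term`, `envelope_at_window`,
  `twisted_at_window`, `term_one`∕`term_two`∕`term_three`, ★ `final_row_logFree` (`E_τ(Q_{2r_f})·log⁶r_f ≤ ε₀r_f` from `r_flog⁶R·κ′ ≤ R`,
  `κ′ ≥ (18ε₁m³C_c + 11664m⁴(√ε₁+1) + 750)∕ε₀`, `τ₀R ≤ 1`), `reg_row`, `tau_r0_le`, `two_rf_le_top`, `window_rows`.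
* §3 ★ `oneStep_socket_logFree` (= LEAD's K-2b `oneStep_socket` with the `(1+log)⁶` deleted; ✓`flat_almostMin_const_slack` inside).
[folklore] ([Giaquinta1984] Ch. III Lemma 2.1 p.86; [SchoenUhlenbeck1982] §4.)
-/

set_option autoImplicit false

noncomputable section

open scoped BigOperators InnerProductSpace
open Finset

namespace Summit.QuantumFields.YangMills.Theorems.PoincareLipschitzImproveOfCoreLetters

open Literature.MathematicalPhysics.QuantumFieldTheory.Balaban1983to89
open B4Eq19LatticeOperators (Zd box unitVec mem_box box_mono box_subset_box self_mem_box add_unitVec_mem_box sub_unitVec_mem_box card_box)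
open Summit.QuantumFields.YangMills.Theorems.PoincareLipschitzKnitFlatEndgame (flat_almostMin_const_slack)
open Summit.QuantumFields.YangMills.Theorems.PoincareLipschitzKnitLadderLetters (box_subset_box_of_mem_box_one card_box_three)
open Summit.QuantumFields.YangMills.Theorems.PoincareLipschitzOrbitMinTwistSlack (energy_twist_le)

variable {d : ℕ} {V : Type*} [NormedAddCommGroup V] [InnerProductSpace ℝ V]

/-! ## §1 Energy comparison and the window radius -/

/-- **`E_τ ≤ 2E + 2τ₀²N`**: the twisted box energy is at most twice the flat one plus `2τ₀²(d·#Q)` (✓`energy_twist_le` + `2τ₀√(N·E) ≤ E + τ₀²N`).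
[folklore] [cite: Giaquinta1984, Ch. III §1 p.64] -/
theorem twist_le_two_mul_flat_add (τ : Fin d → Zd d → (V ≃ₗᵢ[ℝ] V)) {τ₀ : ℝ} (hτ0 : 0 ≤ τ₀) (Q : Finset (Zd d))
    (hτ : ∀ y ∈ Q, ∀ (μ : Fin d) (w : V), ‖τ μ y w - w‖ ≤ τ₀ * ‖w‖) (f : Zd d → V) (hf : ∀ y ∈ Q, ∀ μ : Fin d, ‖f (y + unitVec μ)‖ = 1) :
    ∑ y ∈ Q, ∑ μ, ‖τ μ y (f (y + unitVec μ)) - f y‖ ^ 2 ≤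
      2 * (∑ y ∈ Q, ∑ μ, ‖f (y + unitVec μ) - f y‖ ^ 2) + 2 * (τ₀ ^ 2 * (d * Q.card : ℝ)) := by
  have h := energy_twist_le τ hτ0 Q hτ f hf
  set E : ℝ := ∑ y ∈ Q, ∑ μ, ‖f (y + unitVec μ) - f y‖ ^ 2 with hE
  set N : ℝ := (d * Q.card : ℝ) with hN
  have hE0 : 0 ≤ E := Finset.sum_nonneg fun _ _ => Finset.sum_nonneg fun _ _ => sq_nonneg _
  have hN0 : 0 ≤ N := by rw [hN]; positivity
  set S : ℝ := Real.sqrt (N * E) with hS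
  have hS2 : S * S = N * E := Real.mul_self_sqrt (mul_nonneg hN0 hE0)
  have hamgm : 2 * τ₀ * S ≤ E + τ₀ ^ 2 * N := by
    by_cases hNz : N = 0
    · have hS0 : S = 0 := by rw [hS, hNz, zero_mul, Real.sqrt_zero]
      rw [hS0, hNz]; linarith
    · have hNpos : 0 < N := lt_of_le_of_ne hN0 (Ne.symm hNz)
      have hsq : 0 ≤ N * (E + τ₀ ^ 2 * N - 2 * τ₀ * S) := by
        have e : N * (E + τ₀ ^ 2 * N - 2 * τ₀ * S) = (S - τ₀ * N) ^ 2 := by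
          have : N * E = S * S := hS2.symm
          calc N * (E + τ₀ ^ 2 * N - 2 * τ₀ * S) = N * E + (τ₀ * N) ^ 2 - 2 * (τ₀ * N) * S := by ring
            _ = S * S + (τ₀ * N) ^ 2 - 2 * (τ₀ * N) * S := by rw [this]
            _ = (S - τ₀ * N) ^ 2 := by ring
        rw [e]; positivity
      have := (mul_nonneg_iff_of_pos_left hNpos).mp hsq
      linarith
  linarith

/-- **THE WINDOW RADIUS**: for real `x ≥ 2` the integer `r := ⌊x⌋` has `r ≤ x ≤ 2r`. [folklore] -/
theorem window_radius {x : ℝ} (hx : 2 ≤ x) : ∃ r : ℤ, (r : ℝ) ≤ x ∧ x ≤ 2 * (r : ℝ) := by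
  refine ⟨⌊x⌋, Int.floor_le x, ?_⟩
  have h := Int.lt_floor_add_one x
  linarith

/-- `64 ≤ R ≤ (x∕2)²`, `x > 0` ⟹ `16 ≤ x`. [folklore] -/
theorem sixteen_le_of_sq {R x : ℝ} (hR : 64 ≤ R) (h : R ≤ (x / 2) ^ 2) (hx : 0 < x) : 16 ≤ x := by
  by_contra hc
  push Not at hc
  have h1 : x / 2 < 8 := by linarith
  have h2 : (x / 2) ^ 2 < 8 ^ 2 := by
    have h0 : 0 ≤ x / 2 := by positivity
    nlinarith
  linarith

/-! ## §2 Pure-real rows of the read-off -/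

/-- **THE TOP OF THE LADDER IS BELOW THE LOG-FREE THRESHOLD**: `E_top ≤ 2E_τ(Q_{2r₀}) + 750τ₀²r₀³ ≤ ε₁·m^K` when `E_τ(Q_{2r₀}) ≤ (ε₁∕(4m))r₀`,
`r₀∕m ≤ m^K`, `τ₀r₀ ≤ (4C₀)⁻¹`, `C₀ ≥ max 1 (100m∕ε₁)`. [folklore] [cite: Giaquinta1984, Ch. III Lemma 2.1 p.86] -/
theorem top_threshold_logFree {ε₁ m r₀ MK τ₀ C₀ Eτ0 Etop : ℝ} (hε₁ : 0 < ε₁) (hm : 2 ≤ m) (hr₀ : 1 ≤ r₀)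
    (hMK : r₀ / m ≤ MK) (hEτ0 : Eτ0 ≤ ε₁ / (4 * m) * r₀) (hτ0 : 0 ≤ τ₀) (hτr : τ₀ * r₀ ≤ 1 / (4 * C₀)) (hC₀1 : 1 ≤ C₀)
    (hC₀ : 100 * m / ε₁ ≤ C₀) (hEtop : Etop ≤ 2 * Eτ0 + 750 * τ₀ ^ 2 * r₀ ^ 3) : Etop ≤ ε₁ * MK := by
  have hm0 : 0 < m := by linarith
  have hr₀0 : 0 < r₀ := by linarith
  have hC₀0 : 0 < C₀ := by linarith
  -- the energy half
  have h1 : 2 * Eτ0 ≤ ε₁ / 2 * (r₀ / m) := by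
    have e : ε₁ / (4 * m) * r₀ = 1 / 2 * (ε₁ / 2 * (r₀ / m)) := by field_simp; ring
    rw [e] at hEτ0; linarith
  -- the twist half: `750τ₀²r₀³ = 750r₀(τ₀r₀)² ≤ 750r₀∕(16C₀²) ≤ 750r₀∕(16C₀) ≤ (750∕1600)ε₁r₀∕m`
  have hτr0 : 0 ≤ τ₀ * r₀ := by positivity
  have h2 : (τ₀ * r₀) ^ 2 ≤ (1 / (4 * C₀)) ^ 2 := pow_le_pow_left₀ hτr0 hτr 2
  have h3 : (1 / (4 * C₀)) ^ 2 ≤ 1 / (16 * C₀) := by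
    have e : (1 / (4 * C₀)) ^ 2 = 1 / (16 * C₀) * (1 / C₀) := by field_simp; ring
    rw [e]
    have hC : 1 / C₀ ≤ 1 := by rw [div_le_one hC₀0]; exact hC₀1
    have h0 : 0 ≤ 1 / (16 * C₀) := by positivity
    calc 1 / (16 * C₀) * (1 / C₀) ≤ 1 / (16 * C₀) * 1 := mul_le_mul_of_nonneg_left hC h0
      _ = 1 / (16 * C₀) := mul_one _
  have h4 : 1 / (16 * C₀) ≤ ε₁ / (1600 * m) := by
    -- `C₀ ≥ 100m∕ε₁` ⟺ `16C₀ ≥ 1600m∕ε₁`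
    have hC' : 1600 * m / ε₁ ≤ 16 * C₀ := by
      have := mul_le_mul_of_nonneg_left hC₀ (by norm_num : (0 : ℝ) ≤ 16)
      calc 1600 * m / ε₁ = 16 * (100 * m / ε₁) := by ring
        _ ≤ 16 * C₀ := this
    have hpos : 0 < 1600 * m / ε₁ := by positivity
    calc 1 / (16 * C₀) ≤ 1 / (1600 * m / ε₁) := one_div_le_one_div_of_le hpos hC'
      _ = ε₁ / (1600 * m) := by field_simp
  have h5 : 750 * τ₀ ^ 2 * r₀ ^ 3 ≤ ε₁ / 2 * (r₀ / m) := by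
    have e : 750 * τ₀ ^ 2 * r₀ ^ 3 = 750 * r₀ * (τ₀ * r₀) ^ 2 := by ring
    rw [e]
    have h6 : 750 * r₀ * (τ₀ * r₀) ^ 2 ≤ 750 * r₀ * (ε₁ / (1600 * m)) :=
      mul_le_mul_of_nonneg_left ((h2.trans h3).trans h4) (by positivity)
    have e2 : 750 * r₀ * (ε₁ / (1600 * m)) = (750 / 1600) * (ε₁ * (r₀ / m)) := by field_simp
    have e3 : ε₁ / 2 * (r₀ / m) = (1 / 2) * (ε₁ * (r₀ / m)) := by ring
    have h7 : (750 / 1600 : ℝ) * (ε₁ * (r₀ / m)) ≤ (1 / 2) * (ε₁ * (r₀ / m)) :=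
      mul_le_mul_of_nonneg_right (by norm_num) (by positivity)
    linarith
  have h7 : ε₁ / 2 * (r₀ / m) ≤ ε₁ / 2 * MK := mul_le_mul_of_nonneg_left hMK (by positivity)
  linarith

/-- The main term of the Morrey envelope: `E_top ≤ ε₁m^K`, `R∕(C_cm) ≤ m^K` ⟹ `m²E_top∕(m^K)² ≤ ε₁m³C_c∕R`. [folklore] -/
theorem envelope_main_term {ε₁ m Cc R MK Etop : ℝ} (hε₁ : 0 ≤ ε₁) (hm : 0 < m) (hCc : 0 < Cc) (hR : 0 < R) (hMK0 : 0 < MK)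
    (hMK : R / (Cc * m) ≤ MK) (hEtop : Etop ≤ ε₁ * MK) : m ^ 2 * Etop / MK ^ 2 ≤ ε₁ * m ^ 3 * Cc / R := by
  have h1 : m ^ 2 * Etop / MK ^ 2 ≤ m ^ 2 * (ε₁ * MK) / MK ^ 2 :=
    div_le_div_of_nonneg_right (mul_le_mul_of_nonneg_left hEtop (by positivity)) (by positivity)
  have e1 : m ^ 2 * (ε₁ * MK) / MK ^ 2 = m ^ 2 * ε₁ * (1 / MK) := by field_simp
  have h2 : 1 / MK ≤ 1 / (R / (Cc * m)) := one_div_le_one_div_of_le (by positivity) hMK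
  have e2 : 1 / (R / (Cc * m)) = Cc * m / R := by field_simp
  rw [e1] at h1; rw [e2] at h2
  have h3 := mul_le_mul_of_nonneg_left h2 (by positivity : 0 ≤ m ^ 2 * ε₁)
  have e3 : m ^ 2 * ε₁ * (Cc * m / R) = ε₁ * m ^ 3 * Cc / R := by ring
  linarith

/-- The envelope at the window radius: `E(Q_{2r_f}) ≤ 9r_f²·(ε₁m³C_c∕R + 2m⁴N_s)`. [folklore] -/
theorem envelope_at_window {P m Ns rf MK Etop EzF : ℝ} (hP0 : 0 ≤ P) (hNs : 0 ≤ Ns) (hrf : 1 ≤ rf)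
    (hA : m ^ 2 * Etop / MK ^ 2 ≤ P) (hEzF : EzF ≤ (m ^ 2 * Etop / MK ^ 2 + 2 * (m ^ 2) ^ 2 * Ns) * (2 * rf + 1) ^ 2) :
    EzF ≤ 9 * rf ^ 2 * (P + 2 * m ^ 4 * Ns) := by
  have h9 : (2 * rf + 1) ^ 2 ≤ (3 * rf) ^ 2 := pow_le_pow_left₀ (by linarith) (by linarith) 2
  have h1 : m ^ 2 * Etop / MK ^ 2 + 2 * (m ^ 2) ^ 2 * Ns ≤ P + 2 * m ^ 4 * Ns := by
    have : (m ^ 2) ^ 2 = m ^ 4 := by ring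
    rw [this]; linarith
  have hX0 : 0 ≤ P + 2 * m ^ 4 * Ns := by positivity
  calc EzF ≤ (m ^ 2 * Etop / MK ^ 2 + 2 * (m ^ 2) ^ 2 * Ns) * (2 * rf + 1) ^ 2 := hEzF
    _ ≤ (P + 2 * m ^ 4 * Ns) * (3 * rf) ^ 2 := mul_le_mul h1 h9 (by positivity) hX0
    _ = 9 * rf ^ 2 * (P + 2 * m ^ 4 * Ns) := by ring

/-- The twisted energy at the window radius: `E_τ ≤ 2E + 2τ₀²·3(4r_f+1)³ ≤ 18r_f²P + 36m⁴N_sr_f² + 750τ₀²r_f³`. [folklore] -/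
theorem twisted_at_window {P m Ns rf τ₀ EzF Eτ : ℝ} (hrf : 1 ≤ rf)
    (hEzF : EzF ≤ 9 * rf ^ 2 * (P + 2 * m ^ 4 * Ns)) (hEτ : Eτ ≤ 2 * EzF + 2 * (τ₀ ^ 2 * (3 * (2 * (2 * rf) + 1) ^ 3))) :
    Eτ ≤ 18 * rf ^ 2 * P + 36 * m ^ 4 * Ns * rf ^ 2 + 750 * τ₀ ^ 2 * rf ^ 3 := by
  have h1 : (2 * (2 * rf) + 1) ^ 3 ≤ (5 * rf) ^ 3 := pow_le_pow_left₀ (by linarith) (by linarith) 3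
  have h2 : 3 * (2 * (2 * rf) + 1) ^ 3 ≤ 375 * rf ^ 3 := by nlinarith
  have h3 : 2 * (τ₀ ^ 2 * (3 * (2 * (2 * rf) + 1) ^ 3)) ≤ 750 * τ₀ ^ 2 * rf ^ 3 := by
    have := mul_le_mul_of_nonneg_left h2 (by positivity : 0 ≤ 2 * τ₀ ^ 2)
    linarith
  nlinarith

/-- Term one: `18r_f²·(ε₁m³C_c∕R)·L ≤ 18ε₁m³C_c·r_f∕κ′` from `r_f·L ≤ R∕κ′`. [folklore] -/
theorem term_one {ε₁ m Cc R L rf κ' : ℝ} (hε₁ : 0 ≤ ε₁) (hm : 0 < m) (hCc : 0 < Cc) (hR : 0 < R) (hrf : 0 ≤ rf) (hκ : 0 < κ')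
    (hrfL : rf * L ≤ R / κ') : 18 * rf ^ 2 * (ε₁ * m ^ 3 * Cc / R) * L ≤ 18 * ε₁ * m ^ 3 * Cc * rf / κ' := by
  have e : 18 * rf ^ 2 * (ε₁ * m ^ 3 * Cc / R) * L = (18 * ε₁ * m ^ 3 * Cc * rf / R) * (rf * L) := by ring
  rw [e]
  have h1 : (18 * ε₁ * m ^ 3 * Cc * rf / R) * (rf * L) ≤ (18 * ε₁ * m ^ 3 * Cc * rf / R) * (R / κ') :=
    mul_le_mul_of_nonneg_left hrfL (by positivity)
  have e2 : (18 * ε₁ * m ^ 3 * Cc * rf / R) * (R / κ') = 18 * ε₁ * m ^ 3 * Cc * rf / κ' := by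
    field_simp
  linarith

/-- Term two: `36m⁴N_sr_f²L ≤ 11664m⁴(√ε₁+1)·r_f∕κ′` with `N_s = 324(τ₀√ε₁ + τ₀²m^K)`, `τ₀R ≤ 1`, `τ₀m^K ≤ 1`, `r_f·L ≤ R∕κ′`. [folklore] -/
theorem term_two {ε₁ m R L rf κ' τ₀ MK Ns : ℝ} (hm : 0 < m) (hrf : 0 ≤ rf) (hκ : 0 < κ') (hτ0 : 0 ≤ τ₀)
    (hτR : τ₀ * R ≤ 1) (hτMK : τ₀ * MK ≤ 1) (hMK0 : 0 ≤ MK) (hrfL : rf * L ≤ R / κ') (hNs : Ns = 324 * (τ₀ * Real.sqrt ε₁ + τ₀ ^ 2 * MK)) :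
    36 * m ^ 4 * Ns * rf ^ 2 * L ≤ 11664 * m ^ 4 * (Real.sqrt ε₁ + 1) * rf / κ' := by
  have hsq0 : 0 ≤ Real.sqrt ε₁ := Real.sqrt_nonneg _
  rw [hNs]
  have e : 36 * m ^ 4 * (324 * (τ₀ * Real.sqrt ε₁ + τ₀ ^ 2 * MK)) * rf ^ 2 * L =
      11664 * m ^ 4 * rf * ((τ₀ * Real.sqrt ε₁ + τ₀ ^ 2 * MK) * (rf * L)) := by ring
  rw [e]
  have hq0 : 0 ≤ τ₀ * Real.sqrt ε₁ + τ₀ ^ 2 * MK := by positivity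
  have h1 : (τ₀ * Real.sqrt ε₁ + τ₀ ^ 2 * MK) * (rf * L) ≤ (τ₀ * Real.sqrt ε₁ + τ₀ ^ 2 * MK) * (R / κ') :=
    mul_le_mul_of_nonneg_left hrfL hq0
  have h2 : (τ₀ * Real.sqrt ε₁ + τ₀ ^ 2 * MK) * (R / κ') = ((τ₀ * R) * Real.sqrt ε₁ + (τ₀ * R) * (τ₀ * MK)) / κ' := by ring
  have h3 : (τ₀ * R) * Real.sqrt ε₁ + (τ₀ * R) * (τ₀ * MK) ≤ Real.sqrt ε₁ + 1 := by
    have a1 : (τ₀ * R) * Real.sqrt ε₁ ≤ 1 * Real.sqrt ε₁ := mul_le_mul_of_nonneg_right hτR hsq0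
    have a2 : (τ₀ * R) * (τ₀ * MK) ≤ 1 * 1 := mul_le_mul hτR hτMK (by positivity) zero_le_one
    linarith
  have h4 : ((τ₀ * R) * Real.sqrt ε₁ + (τ₀ * R) * (τ₀ * MK)) / κ' ≤ (Real.sqrt ε₁ + 1) / κ' :=
    div_le_div_of_nonneg_right h3 hκ.le
  have h5 := mul_le_mul_of_nonneg_left ((h1.trans h2.le).trans h4) (by positivity : 0 ≤ 11664 * m ^ 4 * rf)
  have e2 : 11664 * m ^ 4 * rf * ((Real.sqrt ε₁ + 1) / κ') = 11664 * m ^ 4 * (Real.sqrt ε₁ + 1) * rf / κ' := by ring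
  linarith

/-- Term three: `750τ₀²r_f³L ≤ 750·r_f∕κ′` from `τ₀r_f ≤ τ₀R ≤ 1` and `τ₀·r_fL ≤ τ₀R∕κ′ ≤ κ′⁻¹`. [folklore] -/
theorem term_three {R L rf κ' τ₀ : ℝ} (hrf : 0 ≤ rf) (hrfR : rf ≤ R) (hL : 0 ≤ L) (hκ : 0 < κ') (hτ0 : 0 ≤ τ₀) (hτR : τ₀ * R ≤ 1)
    (hrfL : rf * L ≤ R / κ') : 750 * τ₀ ^ 2 * rf ^ 3 * L ≤ 750 * rf / κ' := by
  have e : 750 * τ₀ ^ 2 * rf ^ 3 * L = 750 * rf * ((τ₀ * rf) * (τ₀ * (rf * L))) := by ring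
  rw [e]
  have h1 : τ₀ * rf ≤ 1 := (mul_le_mul_of_nonneg_left hrfR hτ0).trans hτR
  have h2 : τ₀ * (rf * L) ≤ τ₀ * (R / κ') := mul_le_mul_of_nonneg_left hrfL hτ0
  have h3 : τ₀ * (R / κ') = (τ₀ * R) / κ' := by ring
  have h4 : (τ₀ * R) / κ' ≤ 1 / κ' := div_le_div_of_nonneg_right hτR hκ.le
  have h5 : (τ₀ * rf) * (τ₀ * (rf * L)) ≤ 1 * (1 / κ') := mul_le_mul h1 ((h2.trans h3.le).trans h4) (by positivity) zero_le_one
  have h6 := mul_le_mul_of_nonneg_left h5 (by positivity : 0 ≤ 750 * rf)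
  have e2 : 750 * rf * (1 * (1 / κ')) = 750 * rf / κ' := by ring
  linarith

/-- ★ **THE READ-OFF AT THE WINDOW RADIUS** (the arithmetic of record of K-4): `E_τ(Q_{2r_f})·l_f ≤ ε₀·r_f` (`0 ≤ l_f ≤ L = log⁶R`).
[folklore] [cite: Giaquinta1984, Ch. III Lemma 2.1 p.86] -/
theorem final_row_logFree {ε₀ ε₁ m Cc κ' R L rf lf τ₀ MK Etop Ns EzF Eτ : ℝ}
    (hε₀ : 0 < ε₀) (hε₁ : 0 < ε₁) (hm : 2 ≤ m) (hCc : 1 ≤ Cc) (hκ1 : 1 ≤ κ')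
    (hK : (18 * ε₁ * m ^ 3 * Cc + 11664 * m ^ 4 * (Real.sqrt ε₁ + 1) + 750) / ε₀ ≤ κ')
    (hR : 0 < R) (hL : 1 ≤ L) (hrf : 1 ≤ rf) (hrfR : rf * L * κ' ≤ R) (hlf0 : 0 ≤ lf) (hlf : lf ≤ L)
    (hτ0 : 0 ≤ τ₀) (hτR : τ₀ * R ≤ 1) (hMK : R / (Cc * m) ≤ MK) (hMKR : MK ≤ R) (hMK0 : 0 < MK)
    (hEtop : Etop ≤ ε₁ * MK) (hNs : Ns = 324 * (τ₀ * Real.sqrt ε₁ + τ₀ ^ 2 * MK))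
    (hEzF : EzF ≤ (m ^ 2 * Etop / MK ^ 2 + 2 * (m ^ 2) ^ 2 * Ns) * (2 * rf + 1) ^ 2)
    (hEτ : Eτ ≤ 2 * EzF + 2 * (τ₀ ^ 2 * (3 * (2 * (2 * rf) + 1) ^ 3))) :
    Eτ * lf ≤ ε₀ * rf := by
  have hm0 : 0 < m := by linarith
  have hCc0 : 0 < Cc := by linarith
  have hκ0 : 0 < κ' := by linarith
  have hrf0 : 0 < rf := by linarith
  have hNs0 : 0 ≤ Ns := by rw [hNs]; positivity
  have hP0 : 0 ≤ ε₁ * m ^ 3 * Cc / R := by positivity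
  have hA := envelope_main_term hε₁.le hm0 hCc0 hR hMK0 hMK hEtop
  have hB := envelope_at_window hP0 hNs0 hrf hA hEzF
  have hC := twisted_at_window hrf hB hEτ
  have hrfL : rf * L ≤ R / κ' := by rw [le_div_iff₀ hκ0]; linarith
  have hrfR' : rf ≤ R := by
    have h1 : rf ≤ rf * L := le_mul_of_one_le_right hrf0.le hL
    have h2 : rf * L ≤ rf * L * κ' := le_mul_of_one_le_right (by positivity) hκ1
    linarith
  have hτMK : τ₀ * MK ≤ 1 := (mul_le_mul_of_nonneg_left hMKR hτ0).trans hτR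
  have hT1 := term_one hε₁.le hm0 hCc0 hR hrf0.le hκ0 hrfL
  have hT2 := term_two (ε₁ := ε₁) hm0 hrf0.le hκ0 hτ0 hτR hτMK hMK0.le hrfL hNs
  have hT3 := term_three hrf0.le hrfR' (by linarith) hκ0 hτ0 hτR hrfL
  have hB0 : 0 ≤ 18 * rf ^ 2 * (ε₁ * m ^ 3 * Cc / R) + 36 * m ^ 4 * Ns * rf ^ 2 + 750 * τ₀ ^ 2 * rf ^ 3 := by positivity
  have hsum : Eτ * lf ≤ (18 * ε₁ * m ^ 3 * Cc + 11664 * m ^ 4 * (Real.sqrt ε₁ + 1) + 750) * rf / κ' := by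
    calc Eτ * lf ≤ (18 * rf ^ 2 * (ε₁ * m ^ 3 * Cc / R) + 36 * m ^ 4 * Ns * rf ^ 2 + 750 * τ₀ ^ 2 * rf ^ 3) * lf :=
          mul_le_mul_of_nonneg_right hC hlf0
      _ ≤ (18 * rf ^ 2 * (ε₁ * m ^ 3 * Cc / R) + 36 * m ^ 4 * Ns * rf ^ 2 + 750 * τ₀ ^ 2 * rf ^ 3) * L :=
          mul_le_mul_of_nonneg_left hlf hB0
      _ = 18 * rf ^ 2 * (ε₁ * m ^ 3 * Cc / R) * L + 36 * m ^ 4 * Ns * rf ^ 2 * L + 750 * τ₀ ^ 2 * rf ^ 3 * L := by ring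
      _ ≤ 18 * ε₁ * m ^ 3 * Cc * rf / κ' + 11664 * m ^ 4 * (Real.sqrt ε₁ + 1) * rf / κ' + 750 * rf / κ' := by linarith
      _ = (18 * ε₁ * m ^ 3 * Cc + 11664 * m ^ 4 * (Real.sqrt ε₁ + 1) + 750) * rf / κ' := by ring
  have hfin : (18 * ε₁ * m ^ 3 * Cc + 11664 * m ^ 4 * (Real.sqrt ε₁ + 1) + 750) * rf / κ' ≤ ε₀ * rf := by
    rw [div_le_iff₀ hκ0]
    have h1 : 18 * ε₁ * m ^ 3 * Cc + 11664 * m ^ 4 * (Real.sqrt ε₁ + 1) + 750 ≤ κ' * ε₀ := (div_le_iff₀ hε₀).mp hK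
    have h2 := mul_le_mul_of_nonneg_right h1 hrf0.le
    have e : κ' * ε₀ * rf = ε₀ * rf * κ' := by ring
    linarith
  exact hsum.trans hfin

/-- The rows' regime: `τ₀m^K ≤ τ₀R∕2 ≤ (2C₀)⁻¹ ≤ c_T` when `C₀ ≥ (2c_T)⁻¹`. [folklore] -/
theorem reg_row {τ₀ MK R C₀ cT : ℝ} (hτ0 : 0 ≤ τ₀) (hMK : MK ≤ R / 2) (hτR : τ₀ * R ≤ C₀⁻¹) (hC₀0 : 0 < C₀) (hcT : 0 < cT)
    (hC₀cT : 1 / (2 * cT) ≤ C₀) : τ₀ * MK ≤ cT := by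
  have h1 : τ₀ * MK ≤ τ₀ * (R / 2) := mul_le_mul_of_nonneg_left hMK hτ0
  have h2 : τ₀ * (R / 2) = (τ₀ * R) / 2 := by ring
  have h3 : (τ₀ * R) / 2 ≤ C₀⁻¹ / 2 := div_le_div_of_nonneg_right hτR (by norm_num)
  have h4 : C₀⁻¹ ≤ (1 / (2 * cT))⁻¹ := (inv_le_inv₀ hC₀0 (by positivity)).mpr hC₀cT
  rw [one_div, inv_inv] at h4
  linarith

/-- `τ₀r₀ ≤ (4C₀)⁻¹` from `4r₀ ≤ R`, `τ₀R ≤ C₀⁻¹`. [folklore] -/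
theorem tau_r0_le {τ₀ r₀ R C₀ : ℝ} (hτ0 : 0 ≤ τ₀) (h4r : 4 * r₀ ≤ R) (hτR : τ₀ * R ≤ C₀⁻¹) (hC₀0 : 0 < C₀) :
    τ₀ * r₀ ≤ 1 / (4 * C₀) := by
  have h1 : τ₀ * r₀ ≤ τ₀ * (R / 4) := mul_le_mul_of_nonneg_left (by linarith) hτ0
  have h2 : τ₀ * (R / 4) = (τ₀ * R) / 4 := by ring
  have h3 : (τ₀ * R) / 4 ≤ C₀⁻¹ / 4 := div_le_div_of_nonneg_right hτR (by norm_num)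
  have h4 : C₀⁻¹ / 4 = 1 / (4 * C₀) := by rw [inv_eq_one_div]; field_simp
  linarith

/-- `2r_f ≤ m^K`: `r_f ≤ x = R∕(κ′L) ≤ R∕κ′ ≤ C_cr₀∕κ′ ≤ r₀∕(2m)` (`κ′ ≥ 2C_cm`), `r₀∕m ≤ m^K`. [folklore] -/
theorem two_rf_le_top {rf x R κ' L Cc r₀ m MK : ℝ} (hrfx : rf ≤ x) (hx : x = R / (κ' * L)) (hL1 : 1 ≤ L) (hκ0 : 0 < κ')
    (hR0 : 0 ≤ R) (hRle : R ≤ Cc * r₀) (hCc0 : 0 < Cc) (hr₀ : 0 ≤ r₀) (hm0 : 0 < m) (hκ : 2 * Cc * m ≤ κ') (hrM : r₀ / m ≤ MK) :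
    2 * rf ≤ MK := by
  have h1 : x ≤ R / κ' := by
    rw [hx]; exact div_le_div_of_nonneg_left hR0 hκ0 (le_mul_of_one_le_right hκ0.le hL1)
  have h2 : R / κ' ≤ Cc * r₀ / κ' := div_le_div_of_nonneg_right hRle hκ0.le
  have h3 : Cc * r₀ / κ' ≤ Cc * r₀ / (2 * Cc * m) := div_le_div_of_nonneg_left (by positivity) (by positivity) hκ
  have e : Cc * r₀ / (2 * Cc * m) = 1 / 2 * (r₀ / m) := by field_simp
  rw [e] at h3
  linarith

/-- The window rows from `R = κ′·L·x`, `r_f ≤ x ≤ 2r_f`, `κ′ ≥ 2`, `L ≥ 1`: `r_f·L·κ′ ≤ R`, `R ≤ 2κ′·L·r_f`, `2r_f ≤ R`. [folklore] -/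
theorem window_rows {R κ' L x rf : ℝ} (hxR : R = κ' * L * x) (hrfx : rf ≤ x) (hxrf : x ≤ 2 * rf) (hκ2 : 2 ≤ κ') (hL1 : 1 ≤ L)
    (hx0 : 0 ≤ x) : rf * L * κ' ≤ R ∧ R ≤ 2 * κ' * L * rf ∧ 2 * rf ≤ R := by
  have hκL : 2 ≤ κ' * L := by nlinarith
  have hκL0 : 0 ≤ κ' * L := by linarith
  refine ⟨?_, ?_, ?_⟩
  · have := mul_le_mul_of_nonneg_left hrfx hκL0
    calc rf * L * κ' = κ' * L * rf := by ring
      _ ≤ κ' * L * x := this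
      _ = R := hxR.symm
  · have := mul_le_mul_of_nonneg_left hxrf hκL0
    calc R = κ' * L * x := hxR
      _ ≤ κ' * L * (2 * rf) := this
      _ = 2 * κ' * L * rf := by ring
  · have := mul_le_mul_of_nonneg_right hκL hx0
    calc 2 * rf ≤ 2 * x := by linarith
      _ ≤ κ' * L * x := this
      _ = R := hxR.symm

/-! ## §3 The log-free one-step socket at the centre -/

set_option maxHeartbeats 400000 in
/-- ★ **THE LOG-FREE ONE-STEP SOCKET** (= LEAD's K-2b `oneStep_socket` with the `(1+log)⁶` deleted): twisted local minimality in every sub-box of `Q_R(z)` ⟹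
(✓`flat_almostMin_const_slack`) flat almost-minimality with the CONSTANT slack `4τ₀√(3(2r′+1)³·ε₁r′) + 2τ₀²·3(2r′+1)³` on `Q_{r′}(x)`, `x ∈ Q_1(z)`,
`r′ ≤ m^K ≤ 2r₀ − 1`, below the threshold `E ≤ ε₁r′` ⟹ (✓`hLogFreeOneStep_holds`' inner statement) the one-step improvement with source `2·sl`.
[cite: SchoenUhlenbeck1982, §4] -/
theorem oneStep_socket_logFree {A ε ε₁ τ₀ : ℝ} {m K : ℕ} {r R : ℤ}
    (hone : ∀ (u : Zd 3 → EuclideanSpace ℝ (Fin 4)) (x : Zd 3) (r : ℤ) (sl : ℝ), 0 ≤ sl → (∀ y, ‖u y‖ = 1) →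
      (∀ w : Zd 3 → EuclideanSpace ℝ (Fin 4), (∀ y, ‖w y‖ = 1) → (∀ y, y ∉ box x (r - 1) → w y = u y) →
        ∑ y ∈ box x r, ∑ μ : Fin 3, ‖u (y + unitVec μ) - u y‖ ^ 2 ≤ (∑ y ∈ box x r, ∑ μ : Fin 3, ‖w (y + unitVec μ) - w y‖ ^ 2) + sl) →
      (∑ y ∈ box x r, ∑ μ : Fin 3, ‖u (y + unitVec μ) - u y‖ ^ 2) ≤ ε₁ * r →
      ∀ ρ : ℤ, 1 ≤ ρ → ρ + 1 ≤ r →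
        ∑ y ∈ box x ρ, ∑ μ : Fin 3, ‖u (y + unitVec μ) - u y‖ ^ 2 ≤
          (A * (((ρ : ℝ) + 1) / r) ^ 3 + ε) * (∑ y ∈ box x r, ∑ μ : Fin 3, ‖u (y + unitVec μ) - u y‖ ^ 2) + 2 * sl)
    (u : Zd 3 → EuclideanSpace ℝ (Fin 4)) (τ : Fin 3 → Zd 3 → (EuclideanSpace ℝ (Fin 4) ≃ₗᵢ[ℝ] EuclideanSpace ℝ (Fin 4))) (z : Zd 3)
    (hτ0 : 0 ≤ τ₀) (hu : ∀ y, ‖u y‖ = 1)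
    (hdef : ∀ y ∈ box z (R + 1), ∀ (μ : Fin 3) (w : EuclideanSpace ℝ (Fin 4)), ‖τ μ y w - w‖ ≤ τ₀ * ‖w‖)
    (hloc : ∀ (z' : Zd 3) (R' : ℤ), 0 ≤ R' → box z' (R' + 1) ⊆ box z R →
      ∀ v : Zd 3 → EuclideanSpace ℝ (Fin 4), (∀ y, y ∉ box z' R' → v y = u y) → (∀ y ∈ box z' R', ‖v y‖ = 1) →
        ∑ y ∈ box z' (R' + 1), ∑ μ : Fin 3, ‖τ μ y (u (y + unitVec μ)) - u y‖ ^ 2 ≤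
          ∑ y ∈ box z' (R' + 1), ∑ μ : Fin 3, ‖τ μ y (v (y + unitVec μ)) - v y‖ ^ 2)
    (hsub : box z (2 * r) ⊆ box z R) (hKle : (m : ℤ) ^ K ≤ 2 * r - 1) :
    ∀ x ∈ box z (((1 : ℕ) : ℤ)), ∀ ρ r' : ℤ, 1 ≤ ρ → ρ + 1 ≤ r' → r' ≤ (m : ℤ) ^ K →
      ∑ y ∈ box x r', ∑ μ : Fin 3, ‖u (y + unitVec μ) - u y‖ ^ 2 ≤ ε₁ * r' →
      ∑ y ∈ box x ρ, ∑ μ : Fin 3, ‖u (y + unitVec μ) - u y‖ ^ 2 ≤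
        (A * (((ρ : ℝ) + 1) / r') ^ 3 + ε) * (∑ y ∈ box x r', ∑ μ : Fin 3, ‖u (y + unitVec μ) - u y‖ ^ 2) +
          2 * (4 * τ₀ * Real.sqrt (3 * (2 * (r' : ℝ) + 1) ^ 3 * (ε₁ * r')) + 2 * τ₀ ^ 2 * (3 * (2 * (r' : ℝ) + 1) ^ 3)) := by
  intro x hx ρ r' hρ hρr' hr'M hEr'
  have hx1 : x ∈ box z 1 := by simpa using hx
  have hr'2 : (2 : ℤ) ≤ r' := by linarith
  have hsubx2r : box x r' ⊆ box z (2 * r) := box_subset_box_of_mem_box_one hx1 (by linarith [hKle])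
  have hsubxR : box x (r' - 1 + 1) ⊆ box z R := by rw [sub_add_cancel]; exact hsubx2r.trans hsub
  have hdefx : ∀ y ∈ box x (r' - 1 + 1), ∀ (μ : Fin 3) (w : EuclideanSpace ℝ (Fin 4)), ‖τ μ y w - w‖ ≤ τ₀ * ‖w‖ :=
    fun y hy μ w => hdef y ((hsubxR.trans (box_mono z (by linarith))) hy) μ w
  have hlocx := hloc x (r' - 1) (by linarith) hsubxR
  have hEr'' : ∑ y ∈ box x (r' - 1 + 1), ∑ μ, ‖u (y + unitVec μ) - u y‖ ^ 2 ≤ ε₁ * r' := by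
    rw [sub_add_cancel]; exact hEr'
  have halmost := flat_almostMin_const_slack τ hτ0 x (r' - 1) hdefx u hu hlocx hEr''
  rw [sub_add_cancel] at halmost
  have hslk0 : 0 ≤ 4 * τ₀ * Real.sqrt ((((3 : ℕ) : ℝ) * ((box x r').card : ℝ)) * (ε₁ * r')) +
      2 * (τ₀ ^ 2 * (((3 : ℕ) : ℝ) * ((box x r').card : ℝ))) :=
    add_nonneg (mul_nonneg (mul_nonneg (by norm_num) hτ0) (Real.sqrt_nonneg _))
      (mul_nonneg (by norm_num) (mul_nonneg (sq_nonneg _) (mul_nonneg (Nat.cast_nonneg _) (Nat.cast_nonneg _))))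
  have hstep := hone u x r' _ hslk0 hu halmost hEr' ρ hρ hρr'
  have hcard : ((box x r').card : ℝ) = (2 * (r' : ℝ) + 1) ^ 3 := card_box_three x (le_trans (by norm_num) hr'2)
  have hslk_eq : 2 * (4 * τ₀ * Real.sqrt ((((3 : ℕ) : ℝ) * ((box x r').card : ℝ)) * (ε₁ * r')) +
      2 * (τ₀ ^ 2 * (((3 : ℕ) : ℝ) * ((box x r').card : ℝ)))) =
      2 * (4 * τ₀ * Real.sqrt (3 * (2 * (r' : ℝ) + 1) ^ 3 * (ε₁ * r')) + 2 * τ₀ ^ 2 * (3 * (2 * (r' : ℝ) + 1) ^ 3)) := by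
    rw [hcard]; push_cast; ring
  rw [← hslk_eq]
  exact hstep

end Summit.QuantumFields.YangMills.Theorems.PoincareLipschitzImproveOfCoreLetters

end
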